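import Mathlib
import HarnessLib
import Literature.MathematicalPhysics.QuantumFieldTheory.ConstructiveQFTWave0
import Literature.MathematicalPhysics.QuantumLattice.GaugeGroups
import Literature.MathematicalPhysics.QuantumLattice.GaugeGroupsProofs
import Literature.LinearAlgebra.Matrix.UnitaryGramSchmidtRetraction
import Summits.Ventures.LatticeQCDFlow.Scaling.SparsePatchSectors
import Summits.Ventures.LatticeQCDFlow.Scaling.SparsePatchSectorsLattice
import Summits.Ventures.LatticeQCDFlow.Scaling.SparsePatchSectorsLatticeGroups
import Summits.Ventures.LatticeQCDFlow.Scaling.ExposedPatchSectors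
import Summits.Ventures.LatticeQCDFlow.Scaling.ExposedPatchSectorsLattice
import Summits.Ventures.LatticeQCDFlow.Scaling.GaugeFixedPatchSectors
import Summits.Ventures.LatticeQCDFlow.Scaling.GaugeFixedPatchSectorsLattice
import Summits.Ventures.LatticeQCDFlow.Scaling.BoxPeel

/-!
# LatticeQCDFlow / Scaling — the SOLID-BOX tunnelling law: C7(b′) for block updates of an `l^d` box, `SU(N)` and `U(N)` (v3.3, item 87b)

HONEST FRAMING: exact (Metropolis-corrected) sampling algorithms for lattice gauge theory; figures
of merit are autocorrelation/cost numbers at stated couplings and volumes; no continuum-physics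
claim.

THEORY-2.md §3.3 / conjecture C7(b′), FOURTH STEP: the law of `Scaling/GaugeFixedPatchSectorsLattice.lean`
instantiated with the certificate of `Scaling/BoxPeel.lean` for the SOLID BOX `boxLinks x₀ l`
(`3 ≤ l ≤ L - 1`, `d ≥ 2`).

* `§1` rank-only certificates: a ranking such that every updated link is a slot of a plaquette whose
  other updated slots have smaller rank IS a peel certificate, with budgets `w = 2·k^{rk}` (`k ≥ #slots`;
  `Tunnelling.peel_of_rank`) — total budget `W(l) = 2·4^{2l-4}` for the box (the hand certificate of
  THEORY-2.md §0⁺⁺⁺⁺ has the sharper polynomial budget `6l² - 18l + 14`; only the exponential one is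
  certified);
* `§2` the AXIAL GAUGE of the box (`boxGauge`: on interior sites the quotient of the `U`- and
  `V`-holonomies `lineHol` of the axial line from the bottom face, `1` elsewhere) makes every tree link
  agree and changes nothing off the box (`boxGauge_spec`);
* `§3` THE LAW: **`Lattice.compProd_sector_ne_le_of_box`** (generic `G`: `2·4^{2l-4}·c ≤ ρ`, `c + 4r ≤ ε`),
  **`SUN.compProd_sector_ne_le_of_box`** (`∃ r₀(N) > 0 ∀ l ≥ 3, 0 ≤ c, W(l)·c ≤ r₀, (1 + 4W(l))·c ≤ ε`),
  **`UN.compProd_sector_ne_le_of_box`** (`W(l)·c ≤ 1/8`, `(1 + 8W(l))·c ≤ ε`): every `μ`-invariant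
  Markov kernel moving only the links of the box satisfies
  `(μ ⊗ₘ κ){sector_ε ≠ sector_ε'} ≤ 2·μ{∃ p touching the box, dist (U_p, 1) ≥ c}`.

So conjecture C7(b′) HOLDS for solid boxes not wrapping the torus.  NOT covered: update sets that wrap
a cycle of the torus (e.g. a full double time-slice including its temporal links: a centre twist is an
exact move there); the polynomial budget.  `def`s: `lineHol`, `boxGauge`.  No sorry, no new axioms.
-/

noncomputable section

open scoped Matrix.Norms.Frobenius ENNReal ProbabilityTheory
open MeasureTheory ProbabilityTheory Metric Set
open Literature.MathematicalPhysics.QuantumFieldTheory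

/-! ## §1. Rank-only certificates -/

namespace Summit.Ventures.LatticeQCDFlow.Theory2.Tunnelling

variable {E ι S : Type*} [Fintype S] [DecidableEq S]

/-- **A ranking is a peel certificate** with budgets `w e = 2·k^{rk e}` for any `k ≥ #S`. [folklore] -/
theorem peel_of_rank {slot : ι → S → E} {Λ : Set E} {rk : E → ℕ} (k : ℝ) (hk : (Fintype.card S : ℝ) ≤ k)
    (hrank : ∀ e ∈ Λ, ∃ p s, slot p s = e ∧ ∀ s', s' ≠ s → slot p s' ∈ Λ → rk (slot p s') < rk e) :
    ∀ e ∈ Λ, ∃ p s, slot p s = e ∧ (∀ s', s' ≠ s → slot p s' ∈ Λ → rk (slot p s') < rk e) ∧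
      2 + ∑ s' ∈ Finset.univ.erase s, Λ.indicator (fun e => 2 * k ^ rk e) (slot p s') ≤ 2 * k ^ rk e := by
  intro e he
  obtain ⟨p, s, hps, hrk⟩ := hrank e he
  refine ⟨p, s, hps, hrk, ?_⟩
  have hcard : 1 ≤ Fintype.card S := Fintype.card_pos_iff.2 ⟨s⟩
  have hk1 : (1 : ℝ) ≤ k := le_trans (by exact_mod_cast hcard) hk
  rcases Nat.eq_zero_or_pos (rk e) with h0 | hpos
  · have hz : ∑ s' ∈ Finset.univ.erase s, Λ.indicator (fun e => 2 * k ^ rk e) (slot p s') = 0 := by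
      refine Finset.sum_eq_zero fun s' hs' => ?_
      have hne := Finset.ne_of_mem_erase hs'
      by_cases hin : slot p s' ∈ Λ
      · have := hrk s' hne hin
        omega
      · exact Set.indicator_of_notMem hin _
    rw [hz, h0, pow_zero]
    norm_num
  · obtain ⟨r, hr⟩ : ∃ r, rk e = r + 1 := ⟨rk e - 1, by omega⟩
    have hterm : ∀ s' ∈ Finset.univ.erase s,
        Λ.indicator (fun e => 2 * k ^ rk e) (slot p s') ≤ 2 * k ^ r := by
      intro s' hs'
      have hne := Finset.ne_of_mem_erase hs'
      by_cases hin : slot p s' ∈ Λ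
      · rw [Set.indicator_of_mem hin]
        have hlt := hrk s' hne hin
        exact mul_le_mul_of_nonneg_left (pow_le_pow_right₀ hk1 (by omega)) (by norm_num)
      · rw [Set.indicator_of_notMem hin]
        positivity
    have hsum := Finset.sum_le_sum hterm
    rw [Finset.sum_const, Finset.card_erase_of_mem (Finset.mem_univ s), Finset.card_univ,
      nsmul_eq_mul, Nat.cast_sub hcard, Nat.cast_one] at hsum
    have hkr : (1 : ℝ) ≤ k ^ r := one_le_pow₀ hk1
    have hkk : ((Fintype.card S : ℝ) - 1) * (2 * k ^ r) ≤ (k - 1) * (2 * k ^ r) :=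
      mul_le_mul_of_nonneg_right (by linarith) (by positivity)
    rw [hr, pow_succ]
    nlinarith

end Summit.Ventures.LatticeQCDFlow.Theory2.Tunnelling

namespace Summit.Ventures.LatticeQCDFlow.Theory2.Lattice

variable {d L : ℕ}

/-! ## §2. The axial gauge of the box -/

section Gauge

variable {G : Type*} [Group G]

/-- Holonomy of the axial line arriving at `x` from `n` steps below:
`lineHol W (n+1) x = lineHol W n (x - e_{i₀}) · W (x - e_{i₀}, i₀)`. [folklore] -/
def lineHol (i₀ : Fin d) (W : GaugeConfig d L G) : ℕ → Site d L → G
  | 0, _ => 1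
  | n + 1, x => lineHol i₀ W n (unshift x i₀) * W (unshift x i₀, i₀)

open Classical in
/-- The axial gauge transformation taking the updated configuration `V` to the old one `U` along the
tree: on interior sites the quotient of the two axial holonomies from the bottom face, `1` elsewhere.
[folklore] -/
def boxGauge (x₀ : Site d L) (l : ℕ) (i₀ : Fin d) (U V : GaugeConfig d L G) (x : Site d L) : G :=
  if x ∈ boxInterior x₀ l then (lineHol i₀ U (coord x₀ x i₀) x)⁻¹ * lineHol i₀ V (coord x₀ x i₀) x
  else 1

/-- Every link at an interior site is updated. [folklore] -/
theorem mem_boxLinks_of_mem_boxInterior {x₀ : Site d L} {l : ℕ} {x : Site d L}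
    (hx : x ∈ boxInterior x₀ l) (i : Fin d) : (x, i) ∈ boxLinks x₀ l :=
  ⟨fun j => by have := hx j; show coord x₀ x j < l; omega,
    by have := hx i; show coord x₀ x i + 1 < l; omega⟩

/-- Every link into an interior site is updated. [folklore] -/
theorem mem_boxLinks_of_shift_mem_boxInterior [NeZero L] {x₀ : Site d L} {l : ℕ} {x : Site d L}
    {i : Fin d} (hx : x.shift i ∈ boxInterior x₀ l) : (x, i) ∈ boxLinks x₀ l := by
  have hxi : coord x₀ x i = coord x₀ (x.shift i) i - 1 := by
    have h := coord_unshift_self x₀ (x.shift i) i (hx i).1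
    rwa [unshift_shift] at h
  refine ⟨fun j => ?_, ?_⟩
  · show coord x₀ x j < l
    by_cases hj : j = i
    · rw [hj, hxi]; have := hx i; omega
    · have h := coord_unshift_of_ne x₀ (x.shift i) hj
      rw [unshift_shift] at h
      rw [h]; have := hx j; omega
  · show coord x₀ x i + 1 < l
    rw [hxi]; have := hx i; omega

/-- **The axial gauge does its job**: if `U` and `V` agree off the box then `U` and `V^g`
(`g = boxGauge`) agree off `boxLinks \ boxTree` (`3 ≤ l ≤ L - 1`). [folklore] -/
theorem boxGauge_spec [NeZero L] {x₀ : Site d L} {l : ℕ} (hlL : l + 1 ≤ L) (i₀ : Fin d)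
    (U V : GaugeConfig d L G) (hUV : ∀ e ∉ boxLinks x₀ l, U e = V e) :
    ∀ e ∉ boxLinks x₀ l \ boxTree x₀ l i₀, U e = gaugeTransform (boxGauge x₀ l i₀ U V) V e := by
  intro e he
  rw [Set.mem_sdiff, not_and, not_not] at he
  by_cases hbox : e ∈ boxLinks x₀ l
  · -- a tree link
    obtain ⟨hi, hc, hother⟩ := he hbox
    obtain ⟨x, i⟩ := e
    simp only at hi hc hother
    subst hi
    set n := coord x₀ x i with hn
    have hcs : coord x₀ (x.shift i) i = n + 1 := coord_shift_self x₀ x i (by omega)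
    have hI' : x.shift i ∈ boxInterior x₀ l := by
      intro j
      by_cases hj : j = i
      · rw [hj, hcs]; omega
      · rw [coord_shift_of_ne x₀ x hj]; exact hother j hj
    have hg' : boxGauge x₀ l i U V (x.shift i) =
        (lineHol i U n x * U (x, i))⁻¹ * (lineHol i V n x * V (x, i)) := by
      unfold boxGauge
      rw [if_pos hI', hcs]
      simp only [lineHol, unshift_shift]
    show U (x, i) = boxGauge x₀ l i U V x * V (x, i) * (boxGauge x₀ l i U V (x.shift i))⁻¹
    rw [hg']
    by_cases hx : x ∈ boxInterior x₀ l
    · have hg : boxGauge x₀ l i U V x = (lineHol i U n x)⁻¹ * lineHol i V n x := by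
        unfold boxGauge; rw [if_pos hx]
      rw [hg]
      group
    · have hg : boxGauge x₀ l i U V x = 1 := by unfold boxGauge; rw [if_neg hx]
      have hn0 : n = 0 := by
        simp only [boxInterior, mem_setOf_eq, not_forall] at hx
        obtain ⟨j, hj⟩ := hx
        by_cases hji : j = i
        · rw [hji] at hj; omega
        · exact absurd (hother j hji) hj
      have hU1 : lineHol i U n x = 1 := by rw [hn0]; rfl
      have hV1 : lineHol i V n x = 1 := by rw [hn0]; rfl
      rw [hg, hU1, hV1]
      group
  · -- a link off the box: both endpoints are non-interior
    have h1 : e.1 ∉ boxInterior x₀ l := fun h => hbox (mem_boxLinks_of_mem_boxInterior h e.2)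
    have h2 : e.1.shift e.2 ∉ boxInterior x₀ l := fun h => hbox (mem_boxLinks_of_shift_mem_boxInterior h)
    have hg1 : boxGauge x₀ l i₀ U V e.1 = 1 := by unfold boxGauge; rw [if_neg h1]
    have hg2 : boxGauge x₀ l i₀ U V (e.1.shift e.2) = 1 := by unfold boxGauge; rw [if_neg h2]
    show U e = boxGauge x₀ l i₀ U V e.1 * V e * (boxGauge x₀ l i₀ U V (e.1.shift e.2))⁻¹
    rw [hg1, hg2, one_mul, inv_one, mul_one]
    exact hUV e hbox

end Gauge

/-! ## §3. The solid-box tunnelling law -/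

section Law

variable {G : Type*} [Group G] [PseudoMetricSpace G] [MeasurableSpace G]

/-- **Solid-box tunnelling law** (generic `G`: bi-invariant metric, continuous group operations,
connected, `(ρ, r)`-local paths; `d ≥ 2`, `3 ≤ l ≤ L - 1`; thresholds `0 ≤ c`, `2·4^{2l-4}·c ≤ ρ`,
`c + 4r ≤ ε`): every `μ`-invariant Markov kernel moving only the links of the box `x₀ + {0,…,l-1}^d`
satisfies `(μ ⊗ₘ κ){sector_ε ≠ sector_ε'} ≤ 2·μ{∃ p touching the box, dist (U_p, 1) ≥ c}`. [folklore] -/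
theorem compProd_sector_ne_le_of_box [NeZero L] (hd : 2 ≤ d) {l : ℕ} (hl3 : 3 ≤ l) (hlL : l + 1 ≤ L)
    (x₀ : Site d L)
    (hl : ∀ a b c : G, dist (a * b) (a * c) = dist b c) (hr : ∀ a b c : G, dist (a * c) (b * c) = dist a b)
    [ContinuousMul G] [ContinuousInv G] [PreconnectedSpace G]
    {ρ r : ℝ} (hr0 : 0 ≤ r)
    (hpath : ∀ g g' : G, dist g g' ≤ ρ → ∃ γ : ℝ → G, ContinuousOn γ (Icc (0 : ℝ) 1) ∧ γ 0 = g ∧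
      γ 1 = g' ∧ ∀ t ∈ Icc (0 : ℝ) 1, dist (γ t) g ≤ r)
    {c ε : ℝ} (hc : 0 ≤ c) (hcρ : 2 * 4 ^ (2 * l - 4) * c ≤ ρ) (hcr : c + 4 * r ≤ ε)
    (μ : Measure (GaugeConfig d L G)) [SFinite μ]
    (κ : Kernel (GaugeConfig d L G) (GaugeConfig d L G)) [IsMarkovKernel κ] (hinv : κ.Invariant μ)
    (hmove : ∀ᵐ q ∂(μ ⊗ₘ κ), ∀ e ∉ boxLinks x₀ l, q.1 e = q.2 e) :
    (μ ⊗ₘ κ) {q | connectedComponentIn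
          {W : GaugeConfig d L G | ∀ p : Plaquette d L, dist (plaquetteHolonomy W p.1 p.2.1.1 p.2.1.2) 1 < ε} q.1 ≠
        connectedComponentIn
          {W : GaugeConfig d L G | ∀ p : Plaquette d L, dist (plaquetteHolonomy W p.1 p.2.1.1 p.2.1.2) 1 < ε} q.2} ≤
      2 * μ {U | ∃ (p : Plaquette d L) (s : Fin 4), plaqSlot p s ∈ boxLinks x₀ l ∧
        c ≤ dist (plaquetteHolonomy U p.1 p.2.1.1 p.2.1.2) 1} := by
  set i₀ : Fin d := ⟨0, by omega⟩
  set i₁ : Fin d := ⟨1, by omega⟩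
  have h01 : i₀ ≠ i₁ := by simp [i₀, i₁, Fin.ext_iff]
  have hL : 2 ≤ L := by omega
  have hpeel := Tunnelling.peel_of_rank (slot := plaqSlot) (4 : ℝ) (by rw [Fintype.card_fin]; norm_num)
    (boxPeel (x₀ := x₀) hl3 hlL h01)
  refine compProd_sector_ne_le_of_gaugePeelable hL hl hr hr0 hpath hc hcρ hcr Set.sdiff_subset hpeel
    (fun e he => ?_) (fun U V hUV => ⟨boxGauge x₀ l i₀ U V, boxGauge_spec hlL i₀ U V hUV⟩) μ κ hinv hmove
  exact mul_le_mul_of_nonneg_left (pow_le_pow_right₀ (by norm_num) (boxRank_le hl3 h01 he.1)) (by norm_num)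

end Law

end Summit.Ventures.LatticeQCDFlow.Theory2.Lattice

/-! ## §4. `SU(N)` and `U(N)` -/

namespace Summit.Ventures.LatticeQCDFlow.Theory2.Lattice.SUN

open Summit.Ventures.LatticeQCDFlow.Theory2.Lattice

variable {N : ℕ}

/-- **`SU(N)` solid-box tunnelling law** (`N ≥ 1`): `∃ r₀ = r₀(N) > 0` such that for all `l ≥ 3`,
`0 ≤ c`, `2·4^{2l-4}·c ≤ r₀`, `(1 + 8·4^{2l-4})·c ≤ ε`, every `d ≥ 2`, `L ≥ l + 1`, every corner `x₀`,
every s-finite `μ` and every `μ`-invariant Markov kernel moving only the links of the box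
`x₀ + {0,…,l-1}^d`: `(μ ⊗ₘ κ){sector_ε ≠ sector_ε'} ≤ 2·μ{∃ p touching the box, dist (U_p, 1) ≥ c}`.
This is conjecture C7(b′) of THEORY-2.md for solid boxes. [folklore] -/
theorem compProd_sector_ne_le_of_box [NeZero N] : ∃ r₀ : ℝ, 0 < r₀ ∧ ∀ (l : ℕ) (c ε : ℝ), 3 ≤ l →
    0 ≤ c → 2 * 4 ^ (2 * l - 4) * c ≤ r₀ → (1 + 4 * (2 * 4 ^ (2 * l - 4))) * c ≤ ε →
    ∀ {d L : ℕ} [NeZero L], 2 ≤ d → l + 1 ≤ L → ∀ (x₀ : Site d L)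
      (μ : Measure (GaugeConfig d L (Matrix.specialUnitaryGroup (Fin N) ℂ))) [SFinite μ]
      (κ : Kernel (GaugeConfig d L (Matrix.specialUnitaryGroup (Fin N) ℂ))
        (GaugeConfig d L (Matrix.specialUnitaryGroup (Fin N) ℂ))) [IsMarkovKernel κ],
      κ.Invariant μ → (∀ᵐ q ∂(μ ⊗ₘ κ), ∀ e ∉ boxLinks x₀ l, q.1 e = q.2 e) →
      (μ ⊗ₘ κ) {q | connectedComponentIn
            {W | ∀ p : Plaquette d L, dist (plaquetteHolonomy W p.1 p.2.1.1 p.2.1.2) 1 < ε} q.1 ≠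
          connectedComponentIn
            {W | ∀ p : Plaquette d L, dist (plaquetteHolonomy W p.1 p.2.1.1 p.2.1.2) 1 < ε} q.2} ≤
        2 * μ {U | ∃ (p : Plaquette d L) (s : Fin 4), plaqSlot p s ∈ boxLinks x₀ l ∧
          c ≤ dist (plaquetteHolonomy U p.1 p.2.1.1 p.2.1.2) 1} := by
  haveI : Nonempty (Fin N) := ⟨0⟩
  haveI : @ContinuousMul (Matrix.specialUnitaryGroup (Fin N) ℂ)
      (UniformSpace.toTopologicalSpace (self := PseudoMetricSpace.toUniformSpace)) _ :=
    inferInstanceAs (ContinuousMul (Matrix.specialUnitaryGroup (Fin N) ℂ))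
  haveI : @ContinuousInv (Matrix.specialUnitaryGroup (Fin N) ℂ)
      (UniformSpace.toTopologicalSpace (self := PseudoMetricSpace.toUniformSpace)) _ :=
    inferInstanceAs (ContinuousInv (Matrix.specialUnitaryGroup (Fin N) ℂ))
  haveI : @PreconnectedSpace (Matrix.specialUnitaryGroup (Fin N) ℂ)
      (UniformSpace.toTopologicalSpace (self := PseudoMetricSpace.toUniformSpace)) :=
    (Literature.MathematicalPhysics.QuantumLattice.connectedSpace_specialUnitaryGroup
      (n := Fin N)).toPreconnectedSpace
  obtain ⟨r₀, hr₀, hpath⟩ := exists_localPaths_radius (N := N)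
  refine ⟨r₀, hr₀, fun l c ε hl3 hc0 hWc hcε d L _ hd hlL x₀ μ _ κ _ hinv hmove => ?_⟩
  have hWc0 : 0 ≤ 2 * 4 ^ (2 * l - 4) * c := by positivity
  exact Lattice.compProd_sector_ne_le_of_box hd hl3 hlL x₀ dist_mul_left dist_mul_right
    (r := 2 * 4 ^ (2 * l - 4) * c) hWc0 (hpath _ hWc) hc0 (le_refl _) (by nlinarith) μ κ hinv hmove

end Summit.Ventures.LatticeQCDFlow.Theory2.Lattice.SUN

namespace Summit.Ventures.LatticeQCDFlow.Theory2.Lattice.UN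

open Summit.Ventures.LatticeQCDFlow.Theory2.Lattice
open Literature.MathematicalPhysics.QuantumFieldTheory.UnitaryCayley (𝔾)

variable {N : ℕ}

/-- **`U(N)` solid-box tunnelling law with explicit thresholds**: `l ≥ 3`, `0 ≤ c`,
`2·4^{2l-4}·c ≤ 1/8`, `(1 + 16·4^{2l-4})·c ≤ ε`. [folklore] -/
theorem compProd_sector_ne_le_of_box {l : ℕ} (hl3 : 3 ≤ l) {c ε : ℝ} (hc0 : 0 ≤ c)
    (hWc : 2 * 4 ^ (2 * l - 4) * c ≤ 1 / 8) (hcε : (1 + 8 * (2 * 4 ^ (2 * l - 4))) * c ≤ ε)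
    {d L : ℕ} [NeZero L] (hd : 2 ≤ d) (hlL : l + 1 ≤ L) (x₀ : Site d L)
    (μ : Measure (GaugeConfig d L (𝔾 N))) [SFinite μ]
    (κ : Kernel (GaugeConfig d L (𝔾 N)) (GaugeConfig d L (𝔾 N))) [IsMarkovKernel κ] (hinv : κ.Invariant μ)
    (hmove : ∀ᵐ q ∂(μ ⊗ₘ κ), ∀ e ∉ boxLinks x₀ l, q.1 e = q.2 e) :
    (μ ⊗ₘ κ) {q | connectedComponentIn
          {W : GaugeConfig d L (𝔾 N) | ∀ p : Plaquette d L, dist (plaquetteHolonomy W p.1 p.2.1.1 p.2.1.2) 1 < ε} q.1 ≠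
        connectedComponentIn
          {W : GaugeConfig d L (𝔾 N) | ∀ p : Plaquette d L, dist (plaquetteHolonomy W p.1 p.2.1.1 p.2.1.2) 1 < ε} q.2} ≤
      2 * μ {U | ∃ (p : Plaquette d L) (s : Fin 4), plaqSlot p s ∈ boxLinks x₀ l ∧
        c ≤ dist (plaquetteHolonomy U p.1 p.2.1.1 p.2.1.2) 1} := by
  haveI : @ContinuousMul (𝔾 N) (UniformSpace.toTopologicalSpace (self := PseudoMetricSpace.toUniformSpace)) _ :=
    inferInstanceAs (ContinuousMul (𝔾 N))
  haveI : @ContinuousInv (𝔾 N) (UniformSpace.toTopologicalSpace (self := PseudoMetricSpace.toUniformSpace)) _ :=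
    inferInstanceAs (ContinuousInv (𝔾 N))
  haveI : @PreconnectedSpace (𝔾 N) (UniformSpace.toTopologicalSpace (self := PseudoMetricSpace.toUniformSpace)) :=
    inferInstanceAs (PreconnectedSpace (𝔾 N))
  have hWc0 : 0 ≤ 2 * 4 ^ (2 * l - 4) * c := by positivity
  exact Lattice.compProd_sector_ne_le_of_box hd hl3 hlL x₀ dist_mul_left dist_mul_right
    (ρ := 2 * 4 ^ (2 * l - 4) * c) (r := 2 * (2 * 4 ^ (2 * l - 4) * c)) (by positivity)
    (fun g g' h => exists_localPaths hWc0 hWc g g' h) hc0 (le_refl _) (by nlinarith) μ κ hinv hmove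

end Summit.Ventures.LatticeQCDFlow.Theory2.Lattice.UN
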